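/-
PORT (pub-hodgecm2, COR-CM cell) of the stage-1 package file `HodgeCMPerL/HodgeCM/CM/AsymCoeff.lean`
(pub-hodgecm HOME/lean, bytes of record md5 be1e64a69c58, 198 lines). Declarations VERBATIM; edits: imports rewritten to tree
modules, namespace token `HodgeCM` ↦ `Summit.HodgeConjecture.CorCM`, package `conjRingHomK` ↦ tree `Literature.NumberTheory.Automorphic.cmConjRingHom`
(definitionally equal bodies), linter fixes. Generator: pub-hodgecm2-p1 `work/port/build_kit.py`.
Filing delta V2 (pub-hodgecm2-b09): the section-wide `attribute [local instance] Classical.propDecidable` (pkg l.44) is replaced by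
`open scoped Classical in` on the one declaration that needs it (`abar_eq_zero_iff`); declarations and proofs otherwise byte-identical.
-/
/-
Copyright: pub-hodgecm formalisation cell (harness21, 2026). New file (not vendored).
Unit pub-hodgecm-qw8b (QW8 seat 2), session planner-pub-hodgecm-qw8b-0.
-/
import Summits.HodgeConjecture.CorCM.CM.LefschetzChar2

/-!
# Coefficient functionals on `Asym F`: what the Lefschetz character remembers

Pure algebra over `Summit.HodgeConjecture.CorCM.CM.LefschetzChar` (no geometry, no `Universe`, no facts).

`Asym F = ℤ[types of (E, c)] ⧸ ⟨[Ψ] + [Ψ̄]⟩` is the value group of the Lefschetz character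
(`Summit.HodgeConjecture.CorCM.achar`, `Summit.HodgeConjecture.CorCM.lefChar`).  For a type `Ψ₀` the functional `y ↦ y(Ψ₀) − y(Ψ̄₀)` on `ℤ[types]`
kills every relation `[Ψ] + [Ψ̄]`, so it descends to `asymCoeff Ψ₀ : Asym F →ₗ[ℤ] ℤ`
(`asymCoeff_achar`).  Consequently (`lefChar_eq_zero_balanced`): if the Lefschetz character of a weight
`S = (S_j)_j` on `∏_j A_{(F, Θ_j)}` vanishes, then for EVERY type `Ψ₀` the number of `(j, s)`, `s ∈ S_j`, whose
pulled-back type `Θ_j^{(s)}` is `Ψ₀` equals the number whose pulled-back type is `Ψ̄₀` — the multiplicities of a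
character-zero weight are conjugation-balanced.  This is the combinatorial half ("T0") of the dictionary between
`lefChar = 0` and invariance under Milne's group `G(A') = L(A')` used for [QW8] Thm 2.5 step (iv)
(`Summit.HodgeConjecture.CorCM.Universe.Qw8Milne`); see `GAPS.md` § pub-hodgecm-qw8b, entry qw8b-G1, and `pub-hodgecm-qw8b/QW8B-AUDIT.md` §3.
It also makes precise the "injectivity caveat" in the docstring of `Qw8Milne`: `achar` forgets exactly the
conjugation-symmetric part of a multiplicity function and nothing else (`abar_eq_zero_iff`).
-/

noncomputable section

open NumberField NumberField.ComplexEmbedding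

namespace Summit.HodgeConjecture.CorCM

open Literature.AlgebraicGeometry.Motives (CMType)
open Literature.NumberTheory.ComplexMultiplication.CMTypeOps
open Summit.HodgeConjecture.CorCM.Prior.AllgGroup.RfwfAllgGroup
open Finset

section

variable {F : Type} [Field F] [NumberField F]

/-- Conjugation of abstract CM types is an involution: `barCM (barCM Ψ) = Ψ`. -/
theorem barCM_barCM (Ψ : CMF (GalT F) conjT) : barCM (barCM Ψ) = Ψ := by
  apply Subtype.ext
  ext x
  rw [mem_barCM, mem_barCM, not_not]

/-- `barCM` is injective. -/
theorem barCM_injective : Function.Injective (barCM (F := F)) :=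
  Function.LeftInverse.injective barCM_barCM

/-- No abstract CM type equals its conjugate. -/
theorem barCM_ne_self (Ψ : CMF (GalT F) conjT) : barCM Ψ ≠ Ψ := by
  intro h
  have h1 : (1 : GalT F) ∈ (barCM Ψ).1 ↔ (1 : GalT F) ∉ Ψ.1 := mem_barCM Ψ 1
  rw [h] at h1
  exact (iff_not_self h1).elim

/-- `Ψ = barCM Ψ₀ ↔ barCM Ψ = Ψ₀`. -/
theorem eq_barCM_iff (Ψ Ψ₀ : CMF (GalT F) conjT) : Ψ = barCM Ψ₀ ↔ barCM Ψ = Ψ₀ := by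
  constructor
  · rintro rfl
    exact barCM_barCM Ψ₀
  · rintro rfl
    exact (barCM_barCM Ψ).symm

/-- `δ_{Ψ₀} − δ_{Ψ̄₀}` on `ℤ[types]`. -/
def coeffDiff (Ψ₀ : CMF (GalT F) conjT) : (CMF (GalT F) conjT →₀ ℤ) →ₗ[ℤ] ℤ :=
  Finsupp.lapply Ψ₀ - Finsupp.lapply (barCM Ψ₀)

/-- `coeffDiff Ψ₀ y = y Ψ₀ - y Ψ̄₀`: the antisymmetrised coefficient at `Ψ₀`. -/
@[simp] theorem coeffDiff_apply (Ψ₀ : CMF (GalT F) conjT) (y : CMF (GalT F) conjT →₀ ℤ) :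
    coeffDiff Ψ₀ y = y Ψ₀ - y (barCM Ψ₀) := rfl

/-- The pair relations lie in the kernel of `δ_{Ψ₀} − δ_{Ψ̄₀}`. -/
theorem pairRel_le_ker_coeffDiff (Ψ₀ : CMF (GalT F) conjT) :
    pairRel (F := F) ≤ LinearMap.ker (coeffDiff Ψ₀) := by
  unfold pairRel
  refine Submodule.span_le.mpr ?_
  rintro y ⟨Ψ, rfl⟩
  rw [SetLike.mem_coe, LinearMap.mem_ker, coeffDiff_apply]
  simp only [Finsupp.add_apply, Finsupp.single_apply]
  have e1 : (barCM Ψ = barCM Ψ₀) ↔ (Ψ = Ψ₀) := barCM_injective.eq_iff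
  have e2 : (Ψ = barCM Ψ₀) ↔ (barCM Ψ = Ψ₀) := eq_barCM_iff Ψ Ψ₀
  by_cases h1 : Ψ = Ψ₀
  · by_cases h2 : barCM Ψ = Ψ₀
    · rw [if_pos h1, if_pos h2, if_pos (e2.mpr h2), if_pos (e1.mpr h1)]
      norm_num
    · rw [if_pos h1, if_neg h2, if_neg (fun h => h2 (e2.mp h)), if_pos (e1.mpr h1)]
      norm_num
  · by_cases h2 : barCM Ψ = Ψ₀
    · rw [if_neg h1, if_pos h2, if_pos (e2.mpr h2), if_neg (fun h => h1 (e1.mp h))]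
      norm_num
    · rw [if_neg h1, if_neg h2, if_neg (fun h => h2 (e2.mp h)), if_neg (fun h => h1 (e1.mp h))]
      norm_num

/-- **The coefficient functional** `asymCoeff Ψ₀ : Asym F → ℤ`, `[Ψ] ↦ δ_{Ψ,Ψ₀} − δ_{Ψ,Ψ̄₀}`. -/
def asymCoeff (Ψ₀ : CMF (GalT F) conjT) : Asym F →ₗ[ℤ] ℤ :=
  (pairRel (F := F)).liftQ (coeffDiff Ψ₀) (pairRel_le_ker_coeffDiff Ψ₀)

/-- The asymmetric coefficient of `abar y` at `Ψ₀` is `y Ψ₀ - y Ψ̄₀`. -/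
@[simp] theorem asymCoeff_abar (Ψ₀ : CMF (GalT F) conjT) (y : CMF (GalT F) conjT →₀ ℤ) :
    asymCoeff Ψ₀ (abar y) = y Ψ₀ - y (barCM Ψ₀) := by
  rfl

/-- The asymmetric coefficient at `Ψ₀` of the character `achar Ψ` is `[Ψ = Ψ₀] - [Ψ = Ψ̄₀]`. -/
theorem asymCoeff_achar (Ψ₀ Ψ : CMF (GalT F) conjT) :
    asymCoeff Ψ₀ (achar Ψ) = (if Ψ = Ψ₀ then 1 else 0) - (if Ψ = barCM Ψ₀ then 1 else 0) := by
  unfold achar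
  rw [asymCoeff_abar, Finsupp.single_apply, Finsupp.single_apply]

/-- The asymmetric coefficient at `Ψ₀` of the character `achar Ψ` is `[Ψ = Ψ₀] - [Ψ = Ψ̄₀]`. -/
theorem asymCoeff_achar_self (Ψ₀ : CMF (GalT F) conjT) : asymCoeff Ψ₀ (achar Ψ₀) = 1 := by
  rw [asymCoeff_achar, if_pos rfl, if_neg (Ne.symm (barCM_ne_self Ψ₀))]
  rfl

/-- In particular `ā[Ψ] ≠ 0`: a single type is never a pair. -/
theorem achar_ne_zero (Ψ : CMF (GalT F) conjT) : achar Ψ ≠ 0 := by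
  intro h
  have := asymCoeff_achar_self Ψ
  rw [h, map_zero] at this
  exact zero_ne_one this

open scoped Classical in
/-- `ā` forgets exactly the conjugation-symmetric part: `ā(y) = 0 ↔ y(Ψ) = y(Ψ̄)` for all `Ψ`. -/
theorem abar_eq_zero_iff (y : CMF (GalT F) conjT →₀ ℤ) :
    abar y = 0 ↔ ∀ Ψ, y Ψ = y (barCM Ψ) := by
  constructor
  · intro h Ψ
    have := asymCoeff_abar Ψ y
    rw [h, map_zero] at this
    omega
  · intro h
    -- `y = Σ_{Ψ ∈ half} y(Ψ) ([Ψ] + [Ψ̄])` for any half-system; we avoid choosing one by the symmetric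
    -- formula `2·y = Σ_Ψ y(Ψ)([Ψ] + [Ψ̄])`, and use that `Asym F` has no `2`-torsion on the image of such
    -- sums?  Simpler: induct on the support via `Finsupp.induction` is awkward because `h` is not
    -- preserved; instead write `y` as a sum over `univ` of singles and pair terms directly.
    have hy : y = ∑ Ψ ∈ (Finset.univ : Finset (CMF (GalT F) conjT)), Finsupp.single Ψ (y Ψ) :=
      (Finsupp.univ_sum_single y).symm
    -- split `univ` into a half-system `T` and its image under `barCM`
    obtain ⟨T, hT⟩ : ∃ T : Finset (CMF (GalT F) conjT), ∀ Ψ, (Ψ ∈ T ↔ barCM Ψ ∉ T) := by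
      -- choose, in each pair `{Ψ, Ψ̄}`, the member containing `1`
      refine ⟨Finset.univ.filter (fun Ψ => (1 : GalT F) ∈ Ψ.1), fun Ψ => ?_⟩
      simp only [Finset.mem_filter, Finset.mem_univ, true_and, mem_barCM, not_not]
    have huniv : (Finset.univ : Finset (CMF (GalT F) conjT)) = T ∪ T.map ⟨barCM, barCM_injective⟩ := by
      ext Ψ
      simp only [Finset.mem_univ, Finset.mem_union, Finset.mem_map, Function.Embedding.coeFn_mk, true_iff]
      by_cases hΨ : Ψ ∈ T
      · exact Or.inl hΨ
      · right
        refine ⟨barCM Ψ, ?_, barCM_barCM Ψ⟩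
        rw [hT (barCM Ψ), barCM_barCM]
        exact hΨ
    have hdisj : Disjoint T (T.map ⟨barCM, barCM_injective⟩) := by
      rw [Finset.disjoint_left]
      intro Ψ hΨ hΨ'
      rw [Finset.mem_map] at hΨ'
      obtain ⟨Φ, hΦ, hΦΨ⟩ := hΨ'
      simp only [Function.Embedding.coeFn_mk] at hΦΨ
      rw [hT Φ, hΦΨ] at hΦ
      exact hΦ hΨ
    rw [hy, huniv, Finset.sum_union hdisj, Finset.sum_map, ← Finset.sum_add_distrib, map_sum]
    apply Finset.sum_eq_zero
    intro Ψ _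
    simp only [Function.Embedding.coeFn_mk]
    rw [← h Ψ, show Finsupp.single Ψ (y Ψ) + Finsupp.single (barCM Ψ) (y Ψ) =
        y Ψ • (Finsupp.single Ψ (1 : ℤ) + Finsupp.single (barCM Ψ) 1) by
      rw [smul_add, Finsupp.smul_single_one, Finsupp.smul_single_one], map_smul]
    have h0 : abar (F := F) (Finsupp.single Ψ (1 : ℤ) + Finsupp.single (barCM Ψ) 1) = 0 :=
      (Submodule.Quotient.mk_eq_zero _).mpr (Submodule.subset_span ⟨Ψ, rfl⟩)
    rw [h0]
    exact smul_zero _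

/-- **Multiplicities of a character-zero weight are conjugation-balanced.**  If `a(e_S) = 0` then for every
type `Ψ₀`, `#{(j,s) : s ∈ S_j, Θ_j^{(s)} = Ψ₀} = #{(j,s) : s ∈ S_j, Θ_j^{(s)} = Ψ̄₀}`. -/
theorem lefChar_eq_zero_balanced {n : ℕ} (Θ : Fin (n + 1) → CMType F)
    (S : Fin (n + 1) → Finset (F →+* ℂ)) (h : lefChar Θ S = 0) (Ψ₀ : CMF (GalT F) conjT) :
    (∑ j, ((S j).filter (fun s => pullType (Θ j) s = Ψ₀)).card) =
      ∑ j, ((S j).filter (fun s => pullType (Θ j) s = barCM Ψ₀)).card := by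
  have h1 := congrArg (asymCoeff Ψ₀) h
  rw [map_zero] at h1
  unfold lefChar at h1
  simp only [map_sum, asymCoeff_achar, Finset.sum_sub_distrib, Finset.sum_boole] at h1
  have h2 := sub_eq_zero.mp h1
  exact_mod_cast h2

/-- The same statement with the conjugate type read through the base point: `Θ^{(s̄)} = \overline{Θ^{(s)}}`
turns "pulled-back type `Ψ̄₀`" into "pulled-back type of the conjugate embedding is `Ψ₀`". -/
theorem lefChar_eq_zero_balanced' {n : ℕ} (Θ : Fin (n + 1) → CMType F)
    (S : Fin (n + 1) → Finset (F →+* ℂ)) (h : lefChar Θ S = 0) (Ψ₀ : CMF (GalT F) conjT) :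
    (∑ j, ((S j).filter (fun s => pullType (Θ j) s = Ψ₀)).card) =
      ∑ j, ((S j).filter (fun s => barCM (pullType (Θ j) s) = Ψ₀)).card := by
  rw [lefChar_eq_zero_balanced Θ S h Ψ₀]
  refine Finset.sum_congr rfl (fun j _ => ?_)
  congr 1
  refine Finset.filter_congr (fun s _ => ?_)
  rw [eq_barCM_iff]

end

end Summit.HodgeConjecture.CorCM

end
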